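import Summits.Ventures.DiscreteObjects.PP12.OrderElevenTriangleKernel
import Summits.Ventures.DiscreteObjects.PP12.OrderElevenTriangleRowsA

/-!
# PP(12), order-11 cell, Case B (`NoTriangleData12`): kernel RUNS — compatibility scans, part D (designs g23)
Framing: lottery ticket; floor = certified bounds/negative ranges.

Cell pub-namedobj (venture DiscreteObjects), target (M). Compatibility scans: for the representatives `k = 0, 1, 2, 3, 4`, no row of `ROWSk` whose `g₁` digit lies in the stated slice has `10` `compat`-partners in `ROWSk` (`scanG`); the slices cover `[0, 16)`, hence `scanOK ROWSk` (assembled in the soundness files).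
Every declaration is closed by `decide +kernel` (kernel shape measured by designs g23: a row walk ≈ 40 s, a scan slice ≤ 5 s, a φ-walk slice ≈ 3 s).
Exact Python mirror of every function and table: pub-namedobj-designs-g23/code/caseB/tri12k.py (all statements below are `True` there too).
No `sorry`, no axioms beyond the standard three; nothing here asserts a census statement by itself.
-/

namespace Summit.Ventures.DiscreteObjects.PP12

namespace Triangle12

set_option maxHeartbeats 400000000 in
/-- representative `0`: the 93 rows with `g₁ ∈ [0, 6)` have `< 10` partners among the 148 rows (13764 tests) -/
theorem scan_0_0_6 : scanG ROWS0 0 6 = true := by decide +kernel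

set_option maxHeartbeats 400000000 in
/-- representative `0`: the 55 rows with `g₁ ∈ [6, 16)` have `< 10` partners among the 148 rows (8140 tests) -/
theorem scan_0_6_16 : scanG ROWS0 6 16 = true := by decide +kernel

set_option maxHeartbeats 400000000 in
/-- representative `1`: the 64 rows with `g₁ ∈ [0, 6)` have `< 10` partners among the 120 rows (7680 tests) -/
theorem scan_1_0_6 : scanG ROWS1 0 6 = true := by decide +kernel

set_option maxHeartbeats 400000000 in
/-- representative `1`: the 56 rows with `g₁ ∈ [6, 16)` have `< 10` partners among the 120 rows (6720 tests) -/
theorem scan_1_6_16 : scanG ROWS1 6 16 = true := by decide +kernel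

set_option maxHeartbeats 400000000 in
/-- representative `2`: the 42 rows with `g₁ ∈ [0, 6)` have `< 10` partners among the 88 rows (3696 tests) -/
theorem scan_2_0_6 : scanG ROWS2 0 6 = true := by decide +kernel

set_option maxHeartbeats 400000000 in
/-- representative `2`: the 46 rows with `g₁ ∈ [6, 16)` have `< 10` partners among the 88 rows (4048 tests) -/
theorem scan_2_6_16 : scanG ROWS2 6 16 = true := by decide +kernel

set_option maxHeartbeats 400000000 in
/-- representative `3`: the 71 rows with `g₁ ∈ [0, 4)` have `< 10` partners among the 182 rows (12922 tests) -/
theorem scan_3_0_4 : scanG ROWS3 0 4 = true := by decide +kernel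

set_option maxHeartbeats 400000000 in
/-- representative `3`: the 65 rows with `g₁ ∈ [4, 8)` have `< 10` partners among the 182 rows (11830 tests) -/
theorem scan_3_4_8 : scanG ROWS3 4 8 = true := by decide +kernel

set_option maxHeartbeats 400000000 in
/-- representative `3`: the 46 rows with `g₁ ∈ [8, 16)` have `< 10` partners among the 182 rows (8372 tests) -/
theorem scan_3_8_16 : scanG ROWS3 8 16 = true := by decide +kernel

set_option maxHeartbeats 400000000 in
/-- representative `4`: the 48 rows with `g₁ ∈ [0, 6)` have `< 10` partners among the 88 rows (4224 tests) -/
theorem scan_4_0_6 : scanG ROWS4 0 6 = true := by decide +kernel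

set_option maxHeartbeats 400000000 in
/-- representative `4`: the 40 rows with `g₁ ∈ [6, 16)` have `< 10` partners among the 88 rows (3520 tests) -/
theorem scan_4_6_16 : scanG ROWS4 6 16 = true := by decide +kernel

end Triangle12

end Summit.Ventures.DiscreteObjects.PP12
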